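import Mathlib
import Literature.Analysis.FluidPDE.ClassicalSolution
import Literature.Analysis.FluidPDE.SpaceTimeCalculus
import Summits.NavierStokesRegularity.NavierStokesRegularity.Theorems.TautLoopKelvinTautLoopLawStepFlowExistsTools
import Summits.NavierStokesRegularity.NavierStokesRegularity.Theorems.TautLoopKelvinTautLoopLawStepFlowTaylorTools
import Summits.NavierStokesRegularity.NavierStokesRegularity.Theorems.TautLoopKelvinTautLoopLawStepSplittingTools
import Summits.NavierStokesRegularity.NavierStokesRegularity.Theorems.TautLoopKelvinTautLoopLawStepWeberTools
import HarnessLib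

/-!
# Route `TautLoopKelvin`, crux `TautLoopLaw` (stmt-NavierStokesRegularity-15249), line
  `Sketch-ideas-r1k1` (Dini–Saks architecture) — tools stub `stub_tautLoopWalk6AAux3`

**The per-slab construction of the random-walk Kelvin scheme** (field side), packaged for the
assembly of skeleton stub 6A `stub_tautLoopWalkSelection`. For fixed viscosity and slab bounds
`B₀, …, B₄, Bt` there are two constants `K₁, K₂ ≥ 0` such that, on every slab `[a, b]`
(`b − a ≤ 1`) carrying a classical Navier–Stokes solution with those bounds, and for every
number `n ≥ 1` of sub-steps `τ = (b − a)/n`, there exist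

* the backward flow maps `A_k = X_k(s_k)` of `u` over `[s_k, s_{k+1}]`, `s_k = a + kτ`,
  normalised at `s_{k+1}` (`stub_tautLoopStepFlowExistsTools`), of class `C¹`, with
  `‖A_k y − y‖ ≤ K₁ τ` and `‖DA_k(y) − (1 − τ Du(s_{k+1})(y))‖ ≤ K₁ τ²`
  (`stub_tautLoopStepFlowTaylorTools`);
* the scheme fields `θ_0 = u(a)`, `θ_{k+1} = (DA_k)† ((M_c θ_k) ∘ A_k)` (six-point average of
  step `c = √(6ντ)`, then exact transport), all continuous;
* a differentiable potential `Q` with `‖θ_n − u(b) − ∇Q‖ ≤ K₂ (b − a)²/n`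
  (`stub_tautLoopStepSplittingTools`);

together with the slope comparison `‖Du(s_{k+1})(y) − Du(b)(x)‖ ≤ B₂ ‖y − x‖ + Bt (b − a)`
(mean value inequality and the time-Lipschitz bound). Folklore (A. J. Chorin 1973; Majda–Bertozzi
2002, §3.4), assembled from the sibling tools files of the line.
-/

noncomputable section

open Set Function Filter Topology Literature.Analysis.FluidPDE
open ContinuousLinearMap (adjoint)
open scoped InnerProductSpace RealInnerProductSpace ContDiff

namespace Summit.NavierStokesRegularity.NavierStokesRegularity.Theorems

set_option linter.dupNamespace false

local notation3 "E3" => EuclideanSpace ℝ (Fin 3)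

local notation3 "𝐞[" i "]" => (EuclideanSpace.single (i : Fin 3) (1:ℝ) : EuclideanSpace ℝ (Fin 3))

/-- Continuity of one scheme step: if `A` is `C¹` and `g` is continuous then
`x ↦ (DA(x))† (M_c g)(A x)` is continuous (the adjoint is a linear isometry of the operator
space, `x ↦ DA(x)` is continuous). [folklore] -/
theorem tautLoopWalk6A_continuous_step {A g : E3 → E3} (hA : ContDiff ℝ 1 A) (hg : Continuous g)
    (c : ℝ) : Continuous fun x => adjoint (fderiv ℝ A x) ((1 / 6 : ℝ) •
      (∑ i : Fin 3, (g (A x + c • 𝐞[i]) + g (A x - c • 𝐞[i])))) := by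
  have hadj : Continuous fun x => adjoint (fderiv ℝ A x) :=
    (ContinuousLinearMap.adjoint : (E3 →L[ℝ] E3) ≃ₗᵢ⋆[ℝ] (E3 →L[ℝ] E3)).continuous.comp
      (hA.continuous_fderiv one_ne_zero)
  have hAc : Continuous A := hA.continuous
  have hS : Continuous fun x => (1 / 6 : ℝ) •
      (∑ i : Fin 3, (g (A x + c • 𝐞[i]) + g (A x - c • 𝐞[i]))) := by
    fun_prop
  exact hadj.clm_apply hS

/-- Slope comparison on a slab: with `‖D²u‖ ≤ B₂` and `Du` time-Lipschitz with constant `Bt`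
on `[a, b]`, `‖Du(s)(y) − Du(b)(x)‖ ≤ B₂ ‖y − x‖ + Bt (b − a)` for `s ∈ [a, b]`. [folklore] -/
theorem tautLoopWalk6A_slope_compare {u : ℝ → E3 → E3} {a b B₂ Bt : ℝ}
    (hu : IsSmoothSpaceTimeOn (Icc a b) u)
    (hu2 : ∀ r ∈ Icc a b, ∀ x, ‖iteratedFDeriv ℝ 2 (u r) x‖ ≤ B₂)
    (hDut : ∀ r ∈ Icc a b, ∀ r' ∈ Icc a b, ∀ x,
      ‖fderiv ℝ (u r') x - fderiv ℝ (u r) x‖ ≤ Bt * |r' - r|) (hBt : 0 ≤ Bt)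
    {s : ℝ} (hs : s ∈ Icc a b) (x y : E3) :
    ‖fderiv ℝ (u s) y - fderiv ℝ (u b) x‖ ≤ B₂ * ‖y - x‖ + Bt * (b - a) := by
  have hb : b ∈ Icc a b := right_mem_Icc.2 (hs.1.trans hs.2)
  have h1 : ‖fderiv ℝ (u s) y - fderiv ℝ (u s) x‖ ≤ B₂ * ‖y - x‖ :=
    tautLoopWeber_norm_fderiv_sub_le ((hu.contDiff_slice hs).of_le (by norm_cast)) (hu2 s hs) x y
  have h2 : ‖fderiv ℝ (u s) x - fderiv ℝ (u b) x‖ ≤ Bt * (b - a) := by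
    refine (hDut b hb s hs x).trans (mul_le_mul_of_nonneg_left ?_ hBt)
    rw [abs_le]
    constructor <;> linarith [hs.1, hs.2]
  calc ‖fderiv ℝ (u s) y - fderiv ℝ (u b) x‖
      = ‖(fderiv ℝ (u s) y - fderiv ℝ (u s) x) + (fderiv ℝ (u s) x - fderiv ℝ (u b) x)‖ := by
        rw [sub_add_sub_cancel]
    _ ≤ _ := norm_add_le_of_le h1 h2

/-- **Tools stub `stub_tautLoopWalk6AAux3`** (registered; the per-slab construction for the
assembly of skeleton stub 6A `stub_tautLoopWalkSelection`): constants `K₁, K₂`, backward flow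
maps over the `n` sub-intervals with their Taylor estimates, the continuous scheme fields, the
splitting remainder modulo a gradient, and the slope comparison. [folklore] -/
theorem stub_tautLoopWalk6AAux3 : ∀ (ν B₀ B₁ B₂ B₃ B₄ Bt : ℝ), 0 < ν → 0 ≤ B₀ → 0 ≤ B₁ → 0 ≤ B₂ → 0 ≤ B₃ → 0 ≤ B₄ → 0 ≤ Bt → ∃ K₁ K₂ : ℝ, 0 ≤ K₁ ∧ 0 ≤ K₂ ∧ ∀ (u : ℝ → EuclideanSpace ℝ (Fin 3) → EuclideanSpace ℝ (Fin 3)) (p : ℝ → EuclideanSpace ℝ (Fin 3) → ℝ) (a b : ℝ) (n : ℕ), 0 < n → a < b → b - a ≤ 1 → Literature.Analysis.FluidPDE.IsClassicalNSSolutionOn (Set.Icc a b) ν 0 u p → (∀ r ∈ Set.Icc a b, ∀ x, ‖u r x‖ ≤ B₀) → (∀ r ∈ Set.Icc a b, ∀ x, ‖fderiv ℝ (u r) x‖ ≤ B₁) → (∀ r ∈ Set.Icc a b, ∀ x, ‖iteratedFDeriv ℝ 2 (u r) x‖ ≤ B₂) → (∀ r ∈ Set.Icc a b, ∀ x, ‖iteratedFDeriv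 ℝ 3 (u r) x‖ ≤ B₃) → (∀ r ∈ Set.Icc a b, ∀ x, ‖iteratedFDeriv ℝ 4 (u r) x‖ ≤ B₄) → (∀ r ∈ Set.Icc a b, ∀ r' ∈ Set.Icc a b, ∀ x, ‖u r' x - u r x‖ ≤ Bt * |r' - r|) → (∀ r ∈ Set.Icc a b, ∀ r' ∈ Set.Icc a b, ∀ x, ‖fderiv ℝ (u r') x - fderiv ℝ (u r) x‖ ≤ Bt * |r' - r|) → (∀ r ∈ Set.Icc a b, ∀ r' ∈ Set.Icc a b, ∀ x, ‖iteratedFDeriv ℝ 2 (u r') x - iteratedFDeriv ℝ 2 (u r) x‖ ≤ Bt * |r' - r|) → ∃ (A : ℕ → EuclideanSpace ℝ (Fin 3) → EuclideanSpace ℝ (Fin 3)) (θ : ℕ → EuclideanSpace ℝ (Fin 3) → EuclideanSpace ℝ (Fin 3)) (Q : EuclideanSpace ℝ (Fin 3) → ℝ), (∀ k, k < n → ContDiff ℝ 1 (A k)) ∧ (∀ k, k < n → ∀ y, ‖A k y - y‖ ≤ K₁ * ((b - a) / n)) ∧ (∀ k, k < n → ∀ y, ‖fderiv ℝ (A k)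 y - (ContinuousLinearMap.id ℝ (EuclideanSpace ℝ (Fin 3)) - ((b - a) / n) • fderiv ℝ (u (a + (k + 1) * ((b - a) / n))) y)‖ ≤ K₁ * ((b - a) / n) ^ 2) ∧ (∀ k, k < n → ∀ x y, ‖fderiv ℝ (u (a + (k + 1) * ((b - a) / n))) y - fderiv ℝ (u b) x‖ ≤ B₂ * ‖y - x‖ + Bt * (b - a)) ∧ (∀ k, k ≤ n → Continuous (θ k)) ∧ θ 0 = u a ∧ (∀ k, k < n → ∀ x, θ (k + 1) x = ContinuousLinearMap.adjoint (fderiv ℝ (A k) x) ((1 / 6 : ℝ) • (∑ i : Fin 3, (θ k (A k x + Real.sqrt (6 * ν * ((b - a) / n)) • EuclideanSpace.single i (1:ℝ)) + θ k (A k x - Real.sqrt (6 * ν * ((b - a) / n)) • EuclideanSpace.single i (1:ℝ)))))) ∧ Differentiable ℝ Q ∧ (∀ x, ‖θ n x - u b x - gradient Q x‖ ≤ K₂ * (b - a) ^ 2 / n) := by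
  intro ν B₀ B₁ B₂ B₃ B₄ Bt hν hB₀ hB₁ hB₂ hB₃ hB₄ hBt
  obtain ⟨K₁, hK₁, hflow⟩ := stub_tautLoopStepFlowTaylorTools B₀ B₁ B₂ Bt hB₀ hB₁ hB₂ hBt
  obtain ⟨K₂, hK₂, hsplit⟩ :=
    stub_tautLoopStepSplittingTools ν B₀ B₁ B₂ B₃ B₄ Bt hν hB₀ hB₁ hB₂ hB₃ hB₄ hBt
  refine ⟨K₁, K₂, hK₁, hK₂, ?_⟩
  intro u p a b n hn hab hba hNS hu0 hu1 hu2 hu3 hu4 hut hDut hD2ut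
  set τ : ℝ := (b - a) / n with hτ
  have hn0 : (0 : ℝ) < n := Nat.cast_pos.2 hn
  have hτ0 : 0 < τ := div_pos (sub_pos.2 hab) hn0
  have hnτ : (n : ℝ) * τ = b - a := by
    rw [hτ]; field_simp
  have hτ1 : τ ≤ 1 := by
    rw [hτ, div_le_one hn0]
    exact hba.trans (Nat.one_le_cast.2 hn)
  -- the sub-intervals `[a + k τ, a + (k + 1) τ]`
  have hsk : ∀ k : ℕ, a + ((k : ℝ) + 1) * τ - (a + k * τ) = τ := fun k => by ring
  have hlt : ∀ k : ℕ, a + (k : ℝ) * τ < a + ((k : ℝ) + 1) * τ := fun k => by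
    linarith [hsk k]
  have hsub : ∀ k : ℕ, k < n → Set.Icc (a + (k : ℝ) * τ) (a + ((k : ℝ) + 1) * τ) ⊆
      Set.Icc a b := by
    intro k hk
    have hk1 : (k : ℝ) + 1 ≤ n := by exact_mod_cast hk
    refine Set.Icc_subset_Icc (le_add_of_nonneg_right (mul_nonneg k.cast_nonneg hτ0.le)) ?_
    calc a + ((k : ℝ) + 1) * τ ≤ a + (n : ℝ) * τ := by gcongr
      _ = b := by rw [hnτ]; ring
  -- the flows on the sub-intervals, normalised at the right end-points
  have hex : ∀ k : ℕ, k < n → ∃ X : ℝ → E3 → E3,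
      IsSmoothSpaceTimeOn (Set.Icc (a + k * τ) (a + (k + 1) * τ)) X ∧
      (∀ r ∈ Set.Icc (a + k * τ) (a + (k + 1) * τ), ∀ y, HasDerivWithinAt (fun r' => X r' y)
        (u r (X r y)) (Set.Icc (a + k * τ) (a + (k + 1) * τ)) r) ∧
      (∀ y, X (a + (k + 1) * τ) y = y) := fun k hk =>
    stub_tautLoopStepFlowExistsTools u (a + k * τ) (a + (k + 1) * τ) B₀ B₁ (hlt k) hB₀ hB₁
      (hNS.smooth_velocity.mono (hsub k hk)) (fun r hr => hu0 r (hsub k hk hr))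
      (fun r hr => hu1 r (hsub k hk hr)) _ (Set.right_mem_Icc.2 (hlt k).le)
  choose! X hXs hXu hXb using hex
  -- Taylor estimates of the backward flow maps `A_k = X_k(s_k)`
  have hT : ∀ k : ℕ, k < n → (∀ y, ‖X k (a + k * τ) y - y‖ ≤ K₁ * τ) ∧
      (∀ y, ‖fderiv ℝ (X k (a + k * τ)) y - (ContinuousLinearMap.id ℝ E3 -
        τ • fderiv ℝ (u (a + (k + 1) * τ)) y)‖ ≤ K₁ * τ ^ 2) := by
    intro k hk
    have h := hflow u (X k) (a + k * τ) (a + (k + 1) * τ) (hlt k) (by rw [hsk k]; exact hτ1)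
      (hNS.smooth_velocity.mono (hsub k hk)) (hXs k hk) (hXu k hk) (hXb k hk)
      (fun r hr => hu0 r (hsub k hk hr)) (fun r hr => hu1 r (hsub k hk hr))
      (fun r hr => hu2 r (hsub k hk hr))
      (fun r hr r' hr' => hut r (hsub k hk hr) r' (hsub k hk hr'))
      (fun r hr r' hr' => hDut r (hsub k hk hr) r' (hsub k hk hr'))
      (a + k * τ) (Set.left_mem_Icc.2 (hlt k).le)
    rw [hsk k] at h
    exact ⟨h.1, h.2.2.2.1⟩
  have hAc : ∀ k : ℕ, k < n → ContDiff ℝ 1 (X k (a + k * τ)) := fun k hk =>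
    ((hXs k hk).contDiff_slice (Set.left_mem_Icc.2 (hlt k).le)).of_le (by norm_cast)
  -- the scheme fields
  let θ : ℕ → E3 → E3 := fun k => @Nat.rec (fun _ => E3 → E3) (u a)
    (fun k θk => fun x => adjoint (fderiv ℝ (X k (a + k * τ)) x) ((1 / 6 : ℝ) •
      (∑ i : Fin 3, (θk (X k (a + k * τ) x + Real.sqrt (6 * ν * τ) • 𝐞[i]) +
        θk (X k (a + k * τ) x - Real.sqrt (6 * ν * τ) • 𝐞[i]))))) k
  have hθ0 : θ 0 = u a := rfl
  have hθrec : ∀ k : ℕ, k < n → ∀ x, θ (k + 1) x =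
      adjoint (fderiv ℝ (X k (a + k * τ)) x) ((1 / 6 : ℝ) •
        (∑ i : Fin 3, (θ k (X k (a + k * τ) x + Real.sqrt (6 * ν * τ) • 𝐞[i]) +
          θ k (X k (a + k * τ) x - Real.sqrt (6 * ν * τ) • 𝐞[i])))) := fun _ _ _ => rfl
  have hθc : ∀ k : ℕ, k ≤ n → Continuous (θ k) := by
    intro k
    induction k with
    | zero =>
      intro _
      exact (hNS.smooth_velocity.contDiff_slice (Set.left_mem_Icc.2 hab.le)).continuous
    | succ k ih =>
      intro hk
      have hkn : k < n := Nat.lt_of_succ_le hk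
      exact tautLoopWalk6A_continuous_step (hAc k hkn) (ih hkn.le) _
  -- the splitting remainder modulo a gradient
  obtain ⟨Q, hQd, hQ⟩ := hsplit u p a b n hn hab hba hNS hu0 hu1 hu2 hu3 hu4 hut hDut hD2ut X θ
    (fun k hk => ⟨hXs k hk, hXu k hk, hXb k hk⟩) hθ0 (fun k hk x => hθrec k hk x)
  refine ⟨fun k => X k (a + k * τ), θ, Q, hAc, fun k hk => (hT k hk).1, fun k hk => (hT k hk).2,
    fun k hk x y => ?_, hθc, hθ0, hθrec, hQd, hQ⟩
  have hs : a + ((k : ℝ) + 1) * τ ∈ Set.Icc a b := hsub k hk (Set.right_mem_Icc.2 (hlt k).le)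
  have h := tautLoopWalk6A_slope_compare hNS.smooth_velocity hu2 hDut hBt hs x y
  exact h

end Summit.NavierStokesRegularity.NavierStokesRegularity.Theorems

end
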